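import Literature.Analysis.FunctionSpaces.ContDiffHolderLeibniz
import Mathlib.Analysis.Calculus.MeanValue
import Mathlib.Analysis.SpecialFunctions.Pow.Real
import HarnessLib

/-!
# Interpolation inequalities for the `C^{k,r}` norms: Landau's inequality and three orders

Analysis/FunctionSpaces support file (everything proved). For the accepted extended norms
`eContDiffHolderNorm k r f = ∑_{j ≤ k} ‖Dʲf‖_∞ + [Dᵏf]_r` of maps `f : E' → Y` between real normed
spaces (`HolderNorm.lean`; Gilbarg–Trudinger §4.1 (4.4)) and their torus versions
`Torus.eContDiffHolderNorm`, this file proves the **interpolation inequalities** that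
Buckmaster–De Lellis–Székelyhidi–Vicol 2019 record in App. A ((A.1):
`[f]_s ≤ C(ε^{r-s}[f]_r + ε^{-s}‖f‖₀)`, (A.3): `[f]_s ≤ C‖f‖₀^{1-s/r}[f]_r^{s/r}`, "the standard
interpolation inequalities on Hölder norms") and use in App. D in the three-level form
`‖b‖_{j+1+α} ≲ ‖b‖_{1+α}^{1-j/N}‖b‖_{N+1+α}^{j/N}`:

* `norm_sub_sub_smul_fderiv_le_of_contDiff`, `norm_fderiv_le_landau` — **Landau's inequality** on a real
  normed space: `‖Df(x)‖ ≤ (2/η)‖f‖_∞ + η‖D²f‖_∞` for every `η > 0` (second-order Taylor bound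
  along segments, then the unit sphere);
* `eSupNorm_iteratedFDeriv_one_le_landau`, `eHolderNorm_iteratedFDeriv_one_le_landau` — its
  `ℝ≥0∞` forms for `‖D¹f‖_∞` and, applied to finite differences `f(· + h) - f`, for `[D¹f]_r`;
* `eContDiffHolderNorm_one_le_landau`, `eContDiffHolderNorm_succ_le_landau` — the **one-step
  additive interpolation** `‖f‖_{k+1,r} ≤ 3η⁻¹‖f‖_{k,r} + η‖f‖_{k+2,r}` (`0 < η ≤ 1`, smooth `f`;
  induction on `k` by the derivative shift `‖f‖_{k+1,r} = ‖f‖_∞ + ‖Df‖_{k,r}`);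
* `landau_additive`, `landau_three_level` — the elementary real-variable consequences for
  sequences `a_k ≥ 0` with `η a_{k+1} ≤ 3 a_k + η² a_{k+2}` (`η ≤ 1`):
  `η^j a_{k₀+j} ≤ C (a_{k₀} + ηⁿ a_{k₀+n})` (induction on `n` with absorption), and, with
  `a_k ≤ 3 a_{k+1}`, the **three-level inequality** `a_{k₀+j} ≤ C a_{k₀}^{1-j/n} a_{k₀+n}^{j/n}`;
* `eContDiffHolderNorm_interpolation`, `Torus.eContDiffHolderNorm_interpolation` — the
  three-level inequality `‖f‖_{k,r} ≤ C ‖f‖_{k₀,r}^{(k₁-k)/(k₁-k₀)} ‖f‖_{k₁,r}^{(k-k₀)/(k₁-k₀)}`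
  (`k₀ ≤ k ≤ k₁`, `k₀ < k₁`, `r ≤ 1`) for smooth maps with finite norms, in particular for smooth
  maps on the flat torus.

## Mathlib / tree search

Mathlib (this pin): `Convex.norm_image_sub_le_of_norm_fderiv_le`,
`norm_image_sub_le_of_norm_deriv_le_segment'`, `ContinuousLinearMap.opNorm_le_of_unit_norm`,
`iteratedFDeriv_sub_apply`, `iteratedFDeriv_comp_add_right`, `norm_iteratedFDeriv_fderiv`; no
Landau–Kolmogorov or Gagliardo–Nirenberg-type inequality for sup/Hölder norms (searched
`Landau`, `Kolmogorov`, `interpolation_inequality`). Tree: `HolderInterpolation`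
(interpolation at one scale between `‖Dᵏf‖_∞`, `‖Dᵏ⁺¹f‖_∞`: `holderWith_of_lipschitzWith_of_edist_le`),
`ContDiffHolderAlgebra` (`eContDiffHolderNorm_le_three_mul_succ`, finiteness on the torus),
`ContDiffHolderLeibniz` (`eContDiffHolderNorm_succ_eq_fderiv`, `edist_le_eHolderNorm_mul_rpow`,
`eHolderNorm_le_of_forall_edist_le`), `TorusHolderBridge` (`eContDiffHolderNorm_zero_eq`,
`eContDiffHolderNorm_one_eq`). Two sibling files landed concurrently with this one and overlap
with its first part: `ContDiffHolderLogConvex` (`‖f‖²_{m+1,α} ≤ 51 ‖f‖_{m,α}‖f‖_{m+2,α}`, via the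
same Taylor bound `norm_sub_sub_smul_fderiv_le` under a Lipschitz hypothesis on `Dg`) and
`HolderInterpolationTorus` (the scale-`h` inequalities `eSupNorm_fderiv_le_of_scale`,
`eHolderNorm_fderiv_le_of_scale` for `fderiv`, and single-function product inequalities
`‖f‖_{p,r}‖f‖_{q,r} ≲ ‖f‖_{k,r}‖f‖_{m,r}` on the torus). What is not there and is proved here: the
`η`-parametrised additive forms in all orders and the three-level inequality with real exponents
for one function between arbitrary orders `k₀ ≤ k ≤ k₁` (the form consumed, for two different
functions `b`, `f`, by the commutator estimate BDSV Prop. D.1).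

## References

* T. Buckmaster, C. De Lellis, L. Székelyhidi Jr., V. Vicol, *Onsager's conjecture for admissible
  weak solutions*, CPAM 72 (2019) = arXiv:1701.08678, App. A (A.1)–(A.3); App. D (use).
* D. Gilbarg, N. Trudinger, *Elliptic PDE of second order* (2001), §6.8, Lemma 6.32/6.35
  (interpolation inequalities for Hölder norms).
* E. Landau, *Einige Ungleichungen für zweimal differentiierbare Funktionen*, Proc. LMS 13
  (1913) 43–49 (the inequality `‖f'‖ ≤ 2(‖f‖ ‖f''‖)^{1/2}`).
-/

noncomputable section

open Set Filter
open scoped NNReal ENNReal ContDiff Topology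

namespace Literature.Analysis.FunctionSpaces

universe u

/-! ## Landau's inequality on a real normed space -/

section Landau

variable {E' Y : Type*} [NormedAddCommGroup E'] [NormedSpace ℝ E'] [NormedAddCommGroup Y]
  [NormedSpace ℝ Y] {f : E' → Y}

omit [NormedSpace ℝ Y] in
/-- A pointwise bound from a finite extended sup norm (local copy of the helper of
`ContDiffHolderLogConvex`). [folklore] -/
private theorem norm_le_toReal_eSupNorm_of_ne_top {X : Type*} {g : X → Y} (h : eSupNorm g ≠ ⊤) (x : X) :
    ‖g x‖ ≤ (eSupNorm g).toReal := by
  have := enorm_le_eSupNorm g x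
  rw [← ofReal_norm] at this
  exact (ENNReal.ofReal_le_iff_le_toReal h).1 this

/-- The norm of the second Fréchet derivative is the norm of `D²f` (local copy of the helper of
`SobolevImbeddingSup`). [folklore] -/
private theorem norm_fderiv_fderiv_eq_norm_iteratedFDeriv_two_apply (f : E' → Y) (y : E') :
    ‖fderiv ℝ (fderiv ℝ f) y‖ = ‖iteratedFDeriv ℝ 2 f y‖ := by
  rw [← norm_iteratedFDeriv_zero (𝕜 := ℝ) (f := fderiv ℝ (fderiv ℝ f)), norm_iteratedFDeriv_fderiv,
    norm_iteratedFDeriv_fderiv]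

/-- **Second-order Taylor bound along a segment**: for a `C²` map with `‖D²f‖ ≤ M₂`,
`‖f(x + ηv) - f(x) - η Df(x)v‖ ≤ M₂ η² ‖v‖²` for `η ≥ 0` (mean value inequality for
`t ↦ f(x + tv) - t Df(x)v`, whose derivative `(Df(x+tv) - Df(x))v` is bounded by `M₂ t ‖v‖²`).
[folklore] -/
theorem norm_sub_sub_smul_fderiv_le_of_contDiff (hf : ContDiff ℝ 2 f) {M₂ : ℝ}
    (h2 : ∀ y, ‖iteratedFDeriv ℝ 2 f y‖ ≤ M₂) (x v : E') {η : ℝ} (hη : 0 ≤ η) :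
    ‖f (x + η • v) - f x - η • fderiv ℝ f x v‖ ≤ M₂ * η * ‖v‖ ^ 2 * η := by
  have hM₂ : 0 ≤ M₂ := (norm_nonneg _).trans (h2 x)
  have hF : ContDiff ℝ 1 (fderiv ℝ f) := hf.fderiv_right (by norm_num)
  have hFd : ∀ y, DifferentiableAt ℝ (fderiv ℝ f) y := fun y =>
    (hF.differentiable one_ne_zero).differentiableAt
  have hfd : ∀ y, DifferentiableAt ℝ f y := fun y =>
    (hf.differentiable (by norm_num)).differentiableAt
  have hbound : ∀ y, ‖fderiv ℝ (fderiv ℝ f) y‖ ≤ M₂ := fun y => by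
    rw [norm_fderiv_fderiv_eq_norm_iteratedFDeriv_two_apply]
    exact h2 y
  -- mean value inequality for `Df`
  have hMV : ∀ y, ‖fderiv ℝ f y - fderiv ℝ f x‖ ≤ M₂ * ‖y - x‖ := fun y =>
    convex_univ.norm_image_sub_le_of_norm_fderiv_le (fun z _ => hFd z) (fun z _ => hbound z)
      (mem_univ x) (mem_univ y)
  -- the auxiliary function of one variable
  set φ : ℝ → Y := fun t => f (x + t • v) - t • fderiv ℝ f x v with hφ
  have hderiv : ∀ t, HasDerivAt φ (fderiv ℝ f (x + t • v) v - fderiv ℝ f x v) t := by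
    intro t
    have hl : HasDerivAt (fun s : ℝ => x + s • v) v t := by
      simpa using ((hasDerivAt_id t).smul_const v).const_add x
    have h1 : HasDerivAt (fun s : ℝ => f (x + s • v)) (fderiv ℝ f (x + t • v) v) t :=
      (hfd (x + t • v)).hasFDerivAt.comp_hasDerivAt t hl
    have h2' : HasDerivAt (fun s : ℝ => s • fderiv ℝ f x v) (fderiv ℝ f x v) t := by
      simpa using (hasDerivAt_id t).smul_const (fderiv ℝ f x v)
    exact h1.sub h2'
  have hbound' : ∀ t ∈ Ico (0 : ℝ) η,
      ‖fderiv ℝ f (x + t • v) v - fderiv ℝ f x v‖ ≤ M₂ * η * ‖v‖ ^ 2 := by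
    intro t ht
    calc ‖fderiv ℝ f (x + t • v) v - fderiv ℝ f x v‖
        = ‖(fderiv ℝ f (x + t • v) - fderiv ℝ f x) v‖ := rfl
      _ ≤ ‖fderiv ℝ f (x + t • v) - fderiv ℝ f x‖ * ‖v‖ := ContinuousLinearMap.le_opNorm _ _
      _ ≤ M₂ * ‖x + t • v - x‖ * ‖v‖ := by
          gcongr
          exact hMV _
      _ = M₂ * t * ‖v‖ ^ 2 := by
          rw [add_sub_cancel_left, norm_smul, Real.norm_of_nonneg ht.1]
          ring
      _ ≤ M₂ * η * ‖v‖ ^ 2 := by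
          gcongr
          exact ht.2.le
  have hseg := norm_image_sub_le_of_norm_deriv_le_segment'
    (fun t _ => (hderiv t).hasDerivWithinAt) hbound' η ⟨hη, le_rfl⟩
  have e : φ η - φ 0 = f (x + η • v) - f x - η • fderiv ℝ f x v := by
    simp only [hφ, zero_smul, add_zero, sub_zero]
    abel
  rw [e, sub_zero] at hseg
  exact hseg

/-- **Landau's inequality** on a real normed space: for a `C²` map with `‖f‖ ≤ M₀` and
`‖D²f‖ ≤ M₂`, `‖Df(x)‖ ≤ (2/η) M₀ + η M₂` for every `η > 0` (Taylor bound at the points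
`x + ηv`, `‖v‖ = 1`; Landau 1913 for functions of one variable). [folklore] -/
theorem norm_fderiv_le_landau (hf : ContDiff ℝ 2 f) {M₀ M₂ : ℝ} (h0 : ∀ y, ‖f y‖ ≤ M₀)
    (h2 : ∀ y, ‖iteratedFDeriv ℝ 2 f y‖ ≤ M₂) {η : ℝ} (hη : 0 < η) (x : E') :
    ‖fderiv ℝ f x‖ ≤ 2 * η⁻¹ * M₀ + η * M₂ := by
  have hM₀ : 0 ≤ M₀ := (norm_nonneg _).trans (h0 x)
  have hM₂ : 0 ≤ M₂ := (norm_nonneg _).trans (h2 x)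
  have hη0 : η ≠ 0 := hη.ne'
  refine ContinuousLinearMap.opNorm_le_of_unit_norm (by positivity) fun v hv => ?_
  have key := norm_sub_sub_smul_fderiv_le_of_contDiff hf h2 x v hη.le
  rw [hv, one_pow, mul_one] at key
  have h3 : η * ‖fderiv ℝ f x v‖ ≤ 2 * M₀ + M₂ * η * η := by
    have e : η • fderiv ℝ f x v =
        (f (x + η • v) - f x) - (f (x + η • v) - f x - η • fderiv ℝ f x v) := by abel
    calc η * ‖fderiv ℝ f x v‖
        = ‖(f (x + η • v) - f x) - (f (x + η • v) - f x - η • fderiv ℝ f x v)‖ := by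
          rw [← e, norm_smul, Real.norm_of_nonneg hη.le]
      _ ≤ ‖f (x + η • v) - f x‖ + ‖f (x + η • v) - f x - η • fderiv ℝ f x v‖ :=
          norm_sub_le _ _
      _ ≤ (‖f (x + η • v)‖ + ‖f x‖) + M₂ * η * η :=
          add_le_add (norm_sub_le (f (x + η • v)) (f x)) key
      _ ≤ (M₀ + M₀) + M₂ * η * η := by
          gcongr
          · exact h0 _
          · exact h0 _
      _ = 2 * M₀ + M₂ * η * η := by ring
  have h4 : η * ‖fderiv ℝ f x v‖ ≤ η * (2 * η⁻¹ * M₀ + η * M₂) := by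
    calc η * ‖fderiv ℝ f x v‖ ≤ 2 * M₀ + M₂ * η * η := h3
      _ = η * (2 * η⁻¹ * M₀ + η * M₂) := by
          field_simp
  exact le_of_mul_le_mul_left h4 hη

/-- **Landau's inequality, sup-norm form**: `‖D¹f‖_∞ ≤ 2η⁻¹ ‖f‖_∞ + η ‖D²f‖_∞` for `C²` maps and
`η > 0` (extended norms; trivial when a right-hand norm is infinite). [folklore] -/
theorem eSupNorm_iteratedFDeriv_one_le_landau (hf : ContDiff ℝ 2 f) {η : ℝ≥0} (hη : 0 < η) :
    eSupNorm (iteratedFDeriv ℝ 1 f) ≤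
      2 * (η : ℝ≥0∞)⁻¹ * eSupNorm f + η * eSupNorm (iteratedFDeriv ℝ 2 f) := by
  have hηtop : (η : ℝ≥0∞)⁻¹ ≠ 0 := ENNReal.inv_ne_zero.2 ENNReal.coe_ne_top
  have hη0 : (η : ℝ≥0∞) ≠ 0 := by exact_mod_cast hη.ne'
  by_cases h0 : eSupNorm f = ⊤
  · have : 2 * (η : ℝ≥0∞)⁻¹ * eSupNorm f = ⊤ := by
      rw [h0, ENNReal.mul_top (mul_ne_zero two_ne_zero hηtop)]
    rw [this, top_add]
    exact le_top
  by_cases h2 : eSupNorm (iteratedFDeriv ℝ 2 f) = ⊤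
  · have : (η : ℝ≥0∞) * eSupNorm (iteratedFDeriv ℝ 2 f) = ⊤ := by
      rw [h2, ENNReal.mul_top hη0]
    rw [this, add_top]
    exact le_top
  set M₀ := (eSupNorm f).toReal with hM₀
  set M₂ := (eSupNorm (iteratedFDeriv ℝ 2 f)).toReal with hM₂
  have hb0 : ∀ y, ‖f y‖ ≤ M₀ := fun y => norm_le_toReal_eSupNorm_of_ne_top h0 y
  have hb2 : ∀ y, ‖iteratedFDeriv ℝ 2 f y‖ ≤ M₂ := fun y => norm_le_toReal_eSupNorm_of_ne_top h2 y
  have hηr : (0 : ℝ) < η := NNReal.coe_pos.2 hη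
  have hM₀' : 0 ≤ M₀ := ENNReal.toReal_nonneg
  have hM₂' : 0 ≤ M₂ := ENNReal.toReal_nonneg
  have eM₀ : ENNReal.ofReal M₀ = eSupNorm f := ENNReal.ofReal_toReal h0
  have eM₂ : ENNReal.ofReal M₂ = eSupNorm (iteratedFDeriv ℝ 2 f) := ENNReal.ofReal_toReal h2
  have eη : ENNReal.ofReal (η : ℝ) = (η : ℝ≥0∞) := ENNReal.ofReal_coe_nnreal
  have eη' : ENNReal.ofReal ((η : ℝ)⁻¹) = (η : ℝ≥0∞)⁻¹ := by
    rw [ENNReal.ofReal_inv_of_pos hηr, eη]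
  refine iSup_le fun x => ?_
  have hx := norm_fderiv_le_landau hf hb0 hb2 hηr x
  rw [← ofReal_norm, norm_iteratedFDeriv_one]
  calc ENNReal.ofReal ‖fderiv ℝ f x‖ ≤ ENNReal.ofReal (2 * (η : ℝ)⁻¹ * M₀ + η * M₂) :=
        ENNReal.ofReal_le_ofReal hx
    _ = 2 * (η : ℝ≥0∞)⁻¹ * eSupNorm f + η * eSupNorm (iteratedFDeriv ℝ 2 f) := by
        rw [ENNReal.ofReal_add (by positivity) (by positivity),
          ENNReal.ofReal_mul (by positivity : (0 : ℝ) ≤ 2 * (η : ℝ)⁻¹),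
          ENNReal.ofReal_mul (by positivity : (0 : ℝ) ≤ 2),
          ENNReal.ofReal_mul hηr.le, eM₀, eM₂, eη, eη', ENNReal.ofReal_ofNat]

/-- **Landau's inequality, Hölder form**: `[D¹f]_r ≤ 2η⁻¹ [f]_r + η [D²f]_r` for `C²` maps and
`η > 0` (the sup-norm form applied to the finite differences `f(· + h) - f`, whose derivatives
are the finite differences of the derivatives). [folklore] -/
theorem eHolderNorm_iteratedFDeriv_one_le_landau (hf : ContDiff ℝ 2 f) {η : ℝ≥0} (hη : 0 < η)
    (r : ℝ≥0) :
    eHolderNorm r (iteratedFDeriv ℝ 1 f) ≤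
      2 * (η : ℝ≥0∞)⁻¹ * eHolderNorm r f + η * eHolderNorm r (iteratedFDeriv ℝ 2 f) := by
  refine eHolderNorm_le_of_forall_edist_le fun x y => ?_
  set h := y - x with hh
  set g : E' → Y := fun z => f (z + h) - f z with hg
  have hsh : ∀ n : ℕ, (n : WithTop ℕ∞) ≤ 2 → ContDiff ℝ n (fun z => f (z + h)) := fun n hn =>
    (hf.of_le hn).comp (contDiff_id.add contDiff_const)
  have hgs : ContDiff ℝ 2 g := (hsh 2 le_rfl).sub hf
  -- derivatives of the finite difference
  have hDg : ∀ n : ℕ, (n : WithTop ℕ∞) ≤ 2 → ∀ z,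
      iteratedFDeriv ℝ n g z = iteratedFDeriv ℝ n f (z + h) - iteratedFDeriv ℝ n f z := by
    intro n hn z
    rw [hg, show (fun z => f (z + h) - f z) = (fun z => f (z + h)) - f from rfl,
      iteratedFDeriv_sub_apply (hsh n hn).contDiffAt (hf.of_le hn).contDiffAt,
      iteratedFDeriv_comp_add_right]
  have hdist : ∀ z, edist (z + h) z = edist x y := by
    intro z
    rw [edist_eq_enorm_sub, add_sub_cancel_left, hh, ← edist_eq_enorm_sub, edist_comm]
  -- sup bounds of `g` and `D²g` by the Hölder seminorms of `f` and `D²f`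
  have hsup0 : eSupNorm g ≤ eHolderNorm r f * edist x y ^ (r : ℝ) := by
    refine iSup_le fun z => ?_
    rw [hg]
    dsimp only
    rw [← edist_eq_enorm_sub, ← hdist z]
    exact edist_le_eHolderNorm_mul_rpow r f _ _
  have hsup2 : eSupNorm (iteratedFDeriv ℝ 2 g) ≤
      eHolderNorm r (iteratedFDeriv ℝ 2 f) * edist x y ^ (r : ℝ) := by
    refine iSup_le fun z => ?_
    rw [hDg 2 le_rfl z, ← edist_eq_enorm_sub, ← hdist z]
    exact edist_le_eHolderNorm_mul_rpow r _ _ _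
  have hL := eSupNorm_iteratedFDeriv_one_le_landau hgs hη
  have hxy : x + h = y := by rw [hh, add_sub_cancel]
  calc edist (iteratedFDeriv ℝ 1 f x) (iteratedFDeriv ℝ 1 f y)
      = ‖iteratedFDeriv ℝ 1 g x‖ₑ := by
        rw [hDg 1 (by norm_num) x, hxy, edist_comm, edist_eq_enorm_sub]
    _ ≤ eSupNorm (iteratedFDeriv ℝ 1 g) := enorm_le_eSupNorm _ x
    _ ≤ 2 * (η : ℝ≥0∞)⁻¹ * eSupNorm g + η * eSupNorm (iteratedFDeriv ℝ 2 g) := hL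
    _ ≤ 2 * (η : ℝ≥0∞)⁻¹ * (eHolderNorm r f * edist x y ^ (r : ℝ)) +
          η * (eHolderNorm r (iteratedFDeriv ℝ 2 f) * edist x y ^ (r : ℝ)) :=
        add_le_add (mul_le_mul' le_rfl hsup0) (mul_le_mul' le_rfl hsup2)
    _ = (2 * (η : ℝ≥0∞)⁻¹ * eHolderNorm r f + η * eHolderNorm r (iteratedFDeriv ℝ 2 f)) *
          edist x y ^ (r : ℝ) := by ring

/-- Two in `ℝ≥0∞` is at most three. [folklore] -/
theorem ennreal_two_le_three : (2 : ℝ≥0∞) ≤ 3 := by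
  exact_mod_cast (by norm_num : (2 : ℝ≥0) ≤ 3)

/-- **One-step additive interpolation, order one**: `‖f‖_{1,r} ≤ 3η⁻¹ ‖f‖_{0,r} + η ‖f‖_{2,r}` for
`C²` maps and `0 < η ≤ 1` (Landau's inequality for `‖D¹f‖_∞` and `[D¹f]_r`; BDSV App. A (A.1)
with `s = 1 + r`, `r = 2 + r`). [folklore] -/
theorem eContDiffHolderNorm_one_le_landau (hf : ContDiff ℝ 2 f) {η : ℝ≥0} (hη : 0 < η)
    (hη1 : η ≤ 1) (r : ℝ≥0) :
    eContDiffHolderNorm 1 r f ≤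
      3 * (η : ℝ≥0∞)⁻¹ * eContDiffHolderNorm 0 r f + η * eContDiffHolderNorm 2 r f := by
  set I : ℝ≥0∞ := (η : ℝ≥0∞)⁻¹ with hI
  have hinv : (1 : ℝ≥0∞) ≤ I := ENNReal.one_le_inv.2 (by exact_mod_cast hη1)
  have A := eSupNorm_iteratedFDeriv_one_le_landau hf hη
  have B := eHolderNorm_iteratedFDeriv_one_le_landau hf hη r
  have h2 : eSupNorm (iteratedFDeriv ℝ 2 f) + eHolderNorm r (iteratedFDeriv ℝ 2 f) ≤
      eContDiffHolderNorm 2 r f := by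
    unfold eContDiffHolderNorm
    rw [Finset.sum_range_succ]
    exact add_le_add le_add_self le_rfl
  have h0' : eSupNorm f ≤ I * eSupNorm f := le_mul_of_one_le_left bot_le hinv
  have hB' : 2 * I * eHolderNorm r f ≤ 3 * I * eHolderNorm r f :=
    mul_le_mul' (mul_le_mul' ennreal_two_le_three le_rfl) le_rfl
  rw [eContDiffHolderNorm_one_eq, eContDiffHolderNorm_zero_eq]
  calc eSupNorm f + eSupNorm (iteratedFDeriv ℝ 1 f) + eHolderNorm r (iteratedFDeriv ℝ 1 f)
      ≤ I * eSupNorm f + (2 * I * eSupNorm f + η * eSupNorm (iteratedFDeriv ℝ 2 f)) +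
          (3 * I * eHolderNorm r f + η * eHolderNorm r (iteratedFDeriv ℝ 2 f)) :=
        add_le_add (add_le_add h0' A) (B.trans (add_le_add hB' le_rfl))
    _ = 3 * I * (eSupNorm f + eHolderNorm r f) +
          η * (eSupNorm (iteratedFDeriv ℝ 2 f) + eHolderNorm r (iteratedFDeriv ℝ 2 f)) := by
        ring
    _ ≤ 3 * I * (eSupNorm f + eHolderNorm r f) + η * eContDiffHolderNorm 2 r f :=
        add_le_add le_rfl (mul_le_mul' le_rfl h2)

end Landau

/-! ## The one-step inequality in all orders -/

section AllOrders

variable {E' : Type u} [NormedAddCommGroup E'] [NormedSpace ℝ E']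

/-- **One-step additive interpolation in all orders**: for smooth maps and `0 < η ≤ 1`,
`‖f‖_{k+1,r} ≤ 3η⁻¹ ‖f‖_{k,r} + η ‖f‖_{k+2,r}` (BDSV App. A (A.1) between consecutive integer
orders). Induction on `k` through the derivative shift `‖f‖_{k+1,r} = ‖f‖_∞ + ‖Df‖_{k,r}`, the
value space being replaced by a space of linear maps (hence one universe). [folklore] -/
theorem eContDiffHolderNorm_succ_le_landau {η : ℝ≥0} (hη : 0 < η) (hη1 : η ≤ 1) (r : ℝ≥0)
    (k : ℕ) :
    ∀ {Y : Type u} [NormedAddCommGroup Y] [NormedSpace ℝ Y] {f : E' → Y}, ContDiff ℝ ∞ f →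
      eContDiffHolderNorm (k + 1) r f ≤
        3 * (η : ℝ≥0∞)⁻¹ * eContDiffHolderNorm k r f + η * eContDiffHolderNorm (k + 2) r f := by
  induction k with
  | zero =>
    intro Y _ _ f hf
    exact eContDiffHolderNorm_one_le_landau (contDiff_infty.1 hf 2) hη hη1 r
  | succ k IH =>
    intro Y _ _ f hf
    have hDf : ContDiff ℝ ∞ (fderiv ℝ f) := hf.fderiv_right le_rfl
    have h := IH hDf
    set I : ℝ≥0∞ := (η : ℝ≥0∞)⁻¹ with hI
    have hinv : (1 : ℝ≥0∞) ≤ I := ENNReal.one_le_inv.2 (by exact_mod_cast hη1)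
    have h3I : (1 : ℝ≥0∞) ≤ 3 * I :=
      one_le_mul_of_one_le_of_one_le (by exact_mod_cast (by norm_num : (1 : ℝ≥0) ≤ 3)) hinv
    rw [eContDiffHolderNorm_succ_eq_fderiv (k + 1) r f, eContDiffHolderNorm_succ_eq_fderiv k r f,
      show k + 1 + 2 = (k + 2) + 1 from rfl, eContDiffHolderNorm_succ_eq_fderiv (k + 2) r f]
    calc eSupNorm f + eContDiffHolderNorm (k + 1) r (fderiv ℝ f)
        ≤ 3 * I * eSupNorm f + (3 * I * eContDiffHolderNorm k r (fderiv ℝ f) +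
            η * eContDiffHolderNorm (k + 2) r (fderiv ℝ f)) :=
          add_le_add (le_mul_of_one_le_left bot_le h3I) h
      _ = 3 * I * (eSupNorm f + eContDiffHolderNorm k r (fderiv ℝ f)) +
            η * eContDiffHolderNorm (k + 2) r (fderiv ℝ f) := by ring
      _ ≤ 3 * I * (eSupNorm f + eContDiffHolderNorm k r (fderiv ℝ f)) +
            η * (eSupNorm f + eContDiffHolderNorm (k + 2) r (fderiv ℝ f)) :=
          add_le_add le_rfl (mul_le_mul' le_rfl le_add_self)

end AllOrders

/-! ## Sequences with the one-step inequality: elementary consequences -/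

section Sequences

/-- **Multi-level additive interpolation** for nonnegative sequences with the one-step
inequality `η a_{k+1} ≤ 3 a_k + η² a_{k+2}` (`0 ≤ η ≤ 1`): for every `m` there is `C ≥ 1` with
`η^j a_{k₀+j} ≤ C (a_{k₀} + η^{m+1} a_{k₀+m+1})` for `j ≤ m + 1` and `0 ≤ η ≤ 1` (induction on
`m`: the level `k₀ + m + 1` is bounded through the one-step inequality and the induction
hypothesis at a smaller parameter, with absorption; BDSV App. A (A.1) in the form
`ε^s[f]_s ≲ ‖f‖₀ + ε^r[f]_r`). [folklore] -/
theorem landau_additive (m : ℕ) : ∃ C : ℝ, 1 ≤ C ∧ ∀ a : ℕ → ℝ, (∀ k, 0 ≤ a k) →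
    (∀ (k : ℕ) (η : ℝ), 0 ≤ η → η ≤ 1 → η * a (k + 1) ≤ 3 * a k + η ^ 2 * a (k + 2)) →
    ∀ (k₀ j : ℕ), j ≤ m + 1 → ∀ η : ℝ, 0 ≤ η → η ≤ 1 →
      η ^ j * a (k₀ + j) ≤ C * (a k₀ + η ^ (m + 1) * a (k₀ + (m + 1))) := by
  induction m with
  | zero =>
    refine ⟨1, le_rfl, fun a ha hS k₀ j hj η hη0 hη1 => ?_⟩
    rw [one_mul]
    rcases Nat.le_one_iff_eq_zero_or_eq_one.1 hj with rfl | rfl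
    · have := mul_nonneg hη0 (ha (k₀ + (0 + 1)))
      simp only [pow_zero, one_mul, add_zero, zero_add, pow_one] at this ⊢
      linarith
    · have := ha k₀
      simp only [pow_one, zero_add]
      linarith
  | succ m IH =>
    obtain ⟨C, hC1, hC⟩ := IH
    have hCpos : 0 < C := by linarith
    set C' : ℝ := (6 * C) ^ (m + 1) with hC'
    have hC'pos : 0 < C' := by positivity
    refine ⟨C * (3 + C'), by nlinarith, fun a ha hS k₀ j hj η hη0 hη1 => ?_⟩
    -- (i) the bound at the level `k₀ + m + 1`
    have hi : ∀ μ : ℝ, 0 ≤ μ → μ ≤ 1 →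
        μ ^ (m + 1) * a (k₀ + (m + 1)) ≤ C' * a k₀ + 2 * (μ ^ (m + 2) * a (k₀ + (m + 2))) := by
      intro μ hμ0 hμ1
      set η' : ℝ := μ / (6 * C) with hη'def
      have hη'0 : 0 ≤ η' := by positivity
      have hη'1 : η' ≤ 1 := by
        rw [hη'def, div_le_one (by positivity)]
        linarith
      have hmul : 6 * C * η' = μ := by
        rw [hη'def]
        field_simp
      have hS' : μ * a (k₀ + (m + 1)) ≤ 3 * a (k₀ + m) + μ ^ 2 * a (k₀ + (m + 2)) :=
        hS (k₀ + m) μ hμ0 hμ1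
      have hIH := hC a ha hS k₀ m (Nat.le_succ m) η' hη'0 hη'1
      have hkey : μ ^ m * a (k₀ + m) ≤
          (6 * C) ^ m * C * a k₀ + 6⁻¹ * (μ ^ (m + 1) * a (k₀ + (m + 1))) := by
        have hpos : (0 : ℝ) ≤ (6 * C) ^ m := by positivity
        have h' := mul_le_mul_of_nonneg_left hIH hpos
        have e1 : (6 * C) ^ m * (η' ^ m * a (k₀ + m)) = μ ^ m * a (k₀ + m) := by
          rw [← mul_assoc, ← mul_pow, hmul]
        have e2 : (6 * C) ^ m * (C * (a k₀ + η' ^ (m + 1) * a (k₀ + (m + 1)))) =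
            (6 * C) ^ m * C * a k₀ + 6⁻¹ * (μ ^ (m + 1) * a (k₀ + (m + 1))) := by
          have : (6 * C) ^ m * (C * (a k₀ + η' ^ (m + 1) * a (k₀ + (m + 1)))) =
              (6 * C) ^ m * C * a k₀ +
                (6 * C * η') ^ m * (6 * C * η') * 6⁻¹ * a (k₀ + (m + 1)) := by ring
          rw [this, hmul]
          ring
        rwa [e1, e2] at h'
      have hX : μ ^ (m + 1) * a (k₀ + (m + 1)) ≤ 3 * ((6 * C) ^ m * C * a k₀) +
          2⁻¹ * (μ ^ (m + 1) * a (k₀ + (m + 1))) + μ ^ (m + 2) * a (k₀ + (m + 2)) := by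
        have hμm : (0 : ℝ) ≤ μ ^ m := by positivity
        calc μ ^ (m + 1) * a (k₀ + (m + 1)) = μ ^ m * (μ * a (k₀ + (m + 1))) := by ring
          _ ≤ μ ^ m * (3 * a (k₀ + m) + μ ^ 2 * a (k₀ + (m + 2))) :=
              mul_le_mul_of_nonneg_left hS' hμm
          _ = 3 * (μ ^ m * a (k₀ + m)) + μ ^ (m + 2) * a (k₀ + (m + 2)) := by ring
          _ ≤ 3 * ((6 * C) ^ m * C * a k₀ + 6⁻¹ * (μ ^ (m + 1) * a (k₀ + (m + 1)))) +
                μ ^ (m + 2) * a (k₀ + (m + 2)) := by linarith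
          _ = _ := by ring
      have habs : μ ^ (m + 1) * a (k₀ + (m + 1)) ≤
          2 * (3 * ((6 * C) ^ m * C * a k₀)) + 2 * (μ ^ (m + 2) * a (k₀ + (m + 2))) := by
        linarith
      calc μ ^ (m + 1) * a (k₀ + (m + 1))
          ≤ 2 * (3 * ((6 * C) ^ m * C * a k₀)) + 2 * (μ ^ (m + 2) * a (k₀ + (m + 2))) := habs
        _ = C' * a k₀ + 2 * (μ ^ (m + 2) * a (k₀ + (m + 2))) := by
            rw [hC']
            ring
    -- (ii) all levels
    have hA : 0 ≤ a k₀ := ha k₀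
    have hB : 0 ≤ η ^ (m + 2) * a (k₀ + (m + 2)) := mul_nonneg (pow_nonneg hη0 _) (ha _)
    rcases Nat.lt_or_ge j (m + 2) with hjlt | hjge
    · have hj' : j ≤ m + 1 := Nat.lt_succ_iff.1 hjlt
      have h1 := hC a ha hS k₀ j hj' η hη0 hη1
      have h2 := hi η hη0 hη1
      calc η ^ j * a (k₀ + j) ≤ C * (a k₀ + η ^ (m + 1) * a (k₀ + (m + 1))) := h1
        _ ≤ C * (a k₀ + (C' * a k₀ + 2 * (η ^ (m + 2) * a (k₀ + (m + 2))))) := by gcongr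
        _ = C * (1 + C') * a k₀ + 2 * C * (η ^ (m + 2) * a (k₀ + (m + 2))) := by ring
        _ ≤ C * (3 + C') * a k₀ + C * (3 + C') * (η ^ (m + 2) * a (k₀ + (m + 2))) := by
            linarith [mul_nonneg hCpos.le hA,
              mul_nonneg (mul_nonneg hCpos.le (by linarith : (0 : ℝ) ≤ 1 + C')) hB]
        _ = C * (3 + C') * (a k₀ + η ^ (m + 1 + 1) * a (k₀ + (m + 1 + 1))) := by ring
    · have hj2 : j = m + 2 := le_antisymm hj hjge
      subst hj2
      have hge1 : 1 ≤ C * (3 + C') := by nlinarith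
      calc η ^ (m + 2) * a (k₀ + (m + 2)) = 1 * (0 + η ^ (m + 2) * a (k₀ + (m + 2))) := by ring
        _ ≤ C * (3 + C') * (a k₀ + η ^ (m + 2) * a (k₀ + (m + 2))) := by gcongr

/-- Zero propagates upwards along a nonnegative sequence with the one-step inequality: if
`a_{k₀} = 0` then `a_{k₀+i} = 0` for all `i` (`a_{k+1} ≤ η a_{k+2}` for every `η ∈ (0,1]`).
[folklore] -/
theorem landau_eq_zero_of_eq_zero {a : ℕ → ℝ} (ha : ∀ k, 0 ≤ a k)
    (hS : ∀ (k : ℕ) (η : ℝ), 0 ≤ η → η ≤ 1 → η * a (k + 1) ≤ 3 * a k + η ^ 2 * a (k + 2))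
    {k₀ : ℕ} (h0 : a k₀ = 0) : ∀ i, a (k₀ + i) = 0 := by
  intro i
  induction i with
  | zero => simpa using h0
  | succ i IH =>
    show a (k₀ + i + 1) = 0
    have key : ∀ η : ℝ, 0 < η → η ≤ 1 → a (k₀ + i + 1) ≤ η * a (k₀ + i + 2) := by
      intro η hη hη1
      have h := hS (k₀ + i) η hη.le hη1
      rw [IH, mul_zero, zero_add, pow_two, mul_assoc] at h
      exact le_of_mul_le_mul_left h hη
    refine le_antisymm ?_ (ha _)
    refine le_of_forall_pos_le_add fun ε hε => ?_
    set Y := a (k₀ + i + 2) with hY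
    have hY0 : 0 ≤ Y := ha _
    have hη : 0 < min 1 (ε / (Y + 1)) := lt_min one_pos (div_pos hε (by linarith))
    calc a (k₀ + i + 1) ≤ min 1 (ε / (Y + 1)) * Y := key _ hη (min_le_left _ _)
      _ ≤ (ε / (Y + 1)) * Y := mul_le_mul_of_nonneg_right (min_le_right _ _) hY0
      _ ≤ (ε / (Y + 1)) * (Y + 1) :=
          mul_le_mul_of_nonneg_left (by linarith) (div_pos hε (by linarith)).le
      _ = 0 + ε := by
          field_simp
          ring

/-- Iterating the comparison of orders `a_k ≤ 3 a_{k+1}`: `a_k ≤ 3^i a_{k+i}`. [folklore] -/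
theorem le_pow_mul_of_le_three_mul {a : ℕ → ℝ} (hM : ∀ k, a k ≤ 3 * a (k + 1)) (k i : ℕ) :
    a k ≤ 3 ^ i * a (k + i) := by
  induction i with
  | zero => simp
  | succ i IH =>
    calc a k ≤ 3 ^ i * a (k + i) := IH
      _ ≤ 3 ^ i * (3 * a (k + i + 1)) := mul_le_mul_of_nonneg_left (hM _) (by positivity)
      _ = 3 ^ (i + 1) * a (k + (i + 1)) := by ring

/-- **Three-level interpolation** for nonnegative sequences with the one-step inequality
`η a_{k+1} ≤ 3 a_k + η² a_{k+2}` (`0 ≤ η ≤ 1`) and the comparison `a_k ≤ 3 a_{k+1}`: for `n ≥ 1`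
there is `C` with `a_{k₀+j} ≤ C a_{k₀}^{1-j/n} a_{k₀+n}^{j/n}` for `j ≤ n` (optimise the parameter
in `landau_additive`: `ηⁿ = a_{k₀}/a_{k₀+n}` when this is `≤ 1`, the comparison of orders
otherwise; BDSV App. A (A.3)). [folklore] -/
theorem landau_three_level {n : ℕ} (hn : 1 ≤ n) : ∃ C : ℝ, 0 ≤ C ∧ ∀ a : ℕ → ℝ, (∀ k, 0 ≤ a k) →
    (∀ (k : ℕ) (η : ℝ), 0 ≤ η → η ≤ 1 → η * a (k + 1) ≤ 3 * a k + η ^ 2 * a (k + 2)) →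
    (∀ k, a k ≤ 3 * a (k + 1)) →
    ∀ (k₀ j : ℕ), j ≤ n →
      a (k₀ + j) ≤ C * a k₀ ^ (1 - (j : ℝ) / n) * a (k₀ + n) ^ ((j : ℝ) / n) := by
  obtain ⟨m, rfl⟩ : ∃ m, n = m + 1 := ⟨n - 1, by omega⟩
  obtain ⟨C, hC1, hC⟩ := landau_additive m
  refine ⟨2 * C + 3 ^ (m + 1), by positivity, fun a ha hS hM k₀ j hj => ?_⟩
  set A := a k₀ with hA
  set B := a (k₀ + (m + 1)) with hB
  have hA0 : 0 ≤ A := ha _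
  have hB0 : 0 ≤ B := ha _
  have hNpos : (0 : ℝ) < ((m + 1 : ℕ) : ℝ) := by positivity
  set θ : ℝ := (j : ℝ) / ((m + 1 : ℕ) : ℝ) with hθ
  have hθ0 : 0 ≤ θ := by positivity
  have hθ1 : θ ≤ 1 := by
    rw [hθ, div_le_one hNpos]
    exact_mod_cast hj
  have hRHS0 : 0 ≤ A ^ (1 - θ) * B ^ θ := mul_nonneg (Real.rpow_nonneg hA0 _) (Real.rpow_nonneg hB0 _)
  have hCC : 0 ≤ 2 * C + 3 ^ (m + 1) := by positivity
  show a (k₀ + j) ≤ (2 * C + 3 ^ (m + 1)) * A ^ (1 - θ) * B ^ θ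
  rcases hA0.eq_or_lt with hAz | hApos
  · -- `A = 0`: everything above vanishes
    have hz := landau_eq_zero_of_eq_zero ha hS hAz.symm j
    rw [hz]
    exact mul_nonneg (mul_nonneg hCC (Real.rpow_nonneg hA0 _)) (Real.rpow_nonneg hB0 _)
  rcases le_or_gt A B with hAB | hBA
  · -- `0 < A ≤ B`: optimise the parameter
    have hBpos : 0 < B := hApos.trans_le hAB
    have hAB0 : 0 ≤ A / B := by positivity
    set η : ℝ := (A / B) ^ (((m + 1 : ℕ) : ℝ)⁻¹) with hηdef
    have hη0 : 0 ≤ η := Real.rpow_nonneg hAB0 _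
    have hηpos : 0 < η := Real.rpow_pos_of_pos (div_pos hApos hBpos) _
    have hη1 : η ≤ 1 := Real.rpow_le_one hAB0 ((div_le_one hBpos).2 hAB) (by positivity)
    have hηN : η ^ (m + 1) = A / B := Real.rpow_inv_natCast_pow hAB0 (Nat.succ_ne_zero m)
    have hηj : η ^ j = A ^ θ / B ^ θ := by
      rw [← Real.div_rpow hA0 hB0, ← Real.rpow_natCast η j, hηdef, ← Real.rpow_mul hAB0,
        hθ, inv_mul_eq_div]
    have h := hC a ha hS k₀ j hj η hη0 hη1
    rw [hηN, div_mul_cancel₀ A hBpos.ne'] at h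
    -- `h : η ^ j * a (k₀ + j) ≤ C * (A + A)`
    have hAθ : A ^ θ ≠ 0 := (Real.rpow_pos_of_pos hApos θ).ne'
    have hBθ : B ^ θ ≠ 0 := (Real.rpow_pos_of_pos hBpos θ).ne'
    have hηjpos : 0 < η ^ j := pow_pos hηpos j
    have h1 : a (k₀ + j) ≤ 2 * C * A / η ^ j := by
      rw [le_div_iff₀ hηjpos]
      linarith
    have h2 : 2 * C * A / η ^ j = 2 * C * (A ^ (1 - θ) * B ^ θ) := by
      rw [hηj, Real.rpow_sub hApos, Real.rpow_one]
      field_simp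
    calc a (k₀ + j) ≤ 2 * C * (A ^ (1 - θ) * B ^ θ) := h2 ▸ h1
      _ ≤ (2 * C + 3 ^ (m + 1)) * (A ^ (1 - θ) * B ^ θ) := by
          gcongr
          have : (0 : ℝ) ≤ 3 ^ (m + 1) := by positivity
          linarith
      _ = (2 * C + 3 ^ (m + 1)) * A ^ (1 - θ) * B ^ θ := by ring
  · -- `B < A`: comparison of orders
    have hcmp := le_pow_mul_of_le_three_mul hM (k₀ + j) (m + 1 - j)
    rw [show k₀ + j + (m + 1 - j) = k₀ + (m + 1) by omega] at hcmp
    -- `hcmp : a (k₀ + j) ≤ 3 ^ (m + 1 - j) * B`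
    have h3 : (3 : ℝ) ^ (m + 1 - j) ≤ 3 ^ (m + 1) :=
      pow_le_pow_right₀ (by norm_num) (Nat.sub_le _ _)
    have hBsplit : B ≤ A ^ (1 - θ) * B ^ θ := by
      rcases hB0.eq_or_lt with hBz | hBpos
      · rw [← hBz]
        exact mul_nonneg (Real.rpow_nonneg hA0 _) (Real.rpow_nonneg le_rfl _)
      · calc B = B ^ ((1 - θ) + θ) := by rw [sub_add_cancel, Real.rpow_one]
          _ = B ^ (1 - θ) * B ^ θ := Real.rpow_add hBpos _ _
          _ ≤ A ^ (1 - θ) * B ^ θ :=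
              mul_le_mul_of_nonneg_right (Real.rpow_le_rpow hB0 hBA.le (sub_nonneg.2 hθ1))
                (Real.rpow_nonneg hB0 _)
    calc a (k₀ + j) ≤ 3 ^ (m + 1 - j) * B := hcmp
      _ ≤ 3 ^ (m + 1) * (A ^ (1 - θ) * B ^ θ) := mul_le_mul h3 hBsplit hB0 (by positivity)
      _ ≤ (2 * C + 3 ^ (m + 1)) * (A ^ (1 - θ) * B ^ θ) := by
          gcongr
          linarith
      _ = (2 * C + 3 ^ (m + 1)) * A ^ (1 - θ) * B ^ θ := by ring

end Sequences

/-! ## The three-level interpolation inequality for the `C^{k,r}` norms -/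

section ThreeLevel

variable {E' Y : Type u} [NormedAddCommGroup E'] [NormedSpace ℝ E'] [NormedAddCommGroup Y]
  [NormedSpace ℝ Y]

/-- The real sequence of `C^{k,r}` norms of a smooth map with finite norms satisfies the
one-step inequality `η a_{k+1} ≤ 3 a_k + η² a_{k+2}` (`0 ≤ η ≤ 1`). [folklore] -/
theorem toReal_eContDiffHolderNorm_one_step {f : E' → Y} (hf : ContDiff ℝ ∞ f) {r : ℝ≥0}
    (hfin : ∀ m, eContDiffHolderNorm m r f < ⊤) (k : ℕ) {η : ℝ} (hη0 : 0 ≤ η) (hη1 : η ≤ 1) :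
    η * (eContDiffHolderNorm (k + 1) r f).toReal ≤
      3 * (eContDiffHolderNorm k r f).toReal + η ^ 2 * (eContDiffHolderNorm (k + 2) r f).toReal := by
  rcases hη0.eq_or_lt with rfl | hηpos
  · simp only [zero_mul, ne_eq, OfNat.ofNat_ne_zero, not_false_eq_true, zero_pow]
    positivity
  set η' : ℝ≥0 := ⟨η, hη0⟩ with hη'
  have hη'pos : 0 < η' := hηpos
  have hη'1 : η' ≤ 1 := hη1
  have h := eContDiffHolderNorm_succ_le_landau (E' := E') hη'pos hη'1 r k hf
  have hk : eContDiffHolderNorm k r f ≠ ⊤ := (hfin k).ne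
  have hk2 : eContDiffHolderNorm (k + 2) r f ≠ ⊤ := (hfin (k + 2)).ne
  have hinv : (η' : ℝ≥0∞)⁻¹ ≠ ⊤ := ENNReal.inv_ne_top.2 (by exact_mod_cast hη'pos.ne')
  have hT1 : 3 * (η' : ℝ≥0∞)⁻¹ * eContDiffHolderNorm k r f ≠ ⊤ :=
    ENNReal.mul_ne_top (ENNReal.mul_ne_top (by norm_num) hinv) hk
  have hT2 : (η' : ℝ≥0∞) * eContDiffHolderNorm (k + 2) r f ≠ ⊤ :=
    ENNReal.mul_ne_top ENNReal.coe_ne_top hk2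
  have h' := ENNReal.toReal_mono (ENNReal.add_ne_top.2 ⟨hT1, hT2⟩) h
  rw [ENNReal.toReal_add hT1 hT2, ENNReal.toReal_mul, ENNReal.toReal_mul, ENNReal.toReal_mul,
    ENNReal.toReal_inv, ENNReal.coe_toReal] at h'
  have e3 : (3 : ℝ≥0∞).toReal = 3 := by norm_num
  rw [e3] at h'
  have hηr : ((η' : ℝ≥0) : ℝ) = η := rfl
  rw [hηr] at h'
  -- `h' : a_{k+1} ≤ 3 η⁻¹ a_k + η a_{k+2}`; multiply by `η`
  have := mul_le_mul_of_nonneg_left h' hη0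
  calc η * (eContDiffHolderNorm (k + 1) r f).toReal
      ≤ η * (3 * η⁻¹ * (eContDiffHolderNorm k r f).toReal +
          η * (eContDiffHolderNorm (k + 2) r f).toReal) := this
    _ = 3 * (eContDiffHolderNorm k r f).toReal + η ^ 2 * (eContDiffHolderNorm (k + 2) r f).toReal := by
        field_simp

/-- **Three-level interpolation inequality for the `C^{k,r}` norms** (BDSV App. A (A.1)/(A.3),
"the standard interpolation inequalities on Hölder norms", in the form used in App. D): for
`r ≤ 1` and integers `k₀ ≤ k ≤ k₁`, `k₀ < k₁`, there is `C` such that for every smooth map `f`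
between real normed spaces (of one universe) with finite `C^{m,r}` norms,
`‖f‖_{k,r} ≤ C ‖f‖_{k₀,r}^{(k₁-k)/(k₁-k₀)} ‖f‖_{k₁,r}^{(k-k₀)/(k₁-k₀)}`. [folklore] -/
theorem eContDiffHolderNorm_interpolation {r : ℝ≥0} (hr : r ≤ 1) {k₀ k k₁ : ℕ} (h₀ : k₀ ≤ k)
    (h₁ : k ≤ k₁) (hlt : k₀ < k₁) :
    ∃ C : ℝ≥0, ∀ f : E' → Y, ContDiff ℝ ∞ f → (∀ m, eContDiffHolderNorm m r f < ⊤) →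
      eContDiffHolderNorm k r f ≤
        C * eContDiffHolderNorm k₀ r f ^ (((k₁ : ℝ) - k) / ((k₁ : ℝ) - k₀)) *
          eContDiffHolderNorm k₁ r f ^ (((k : ℝ) - k₀) / ((k₁ : ℝ) - k₀)) := by
  obtain ⟨C, hC0, hC⟩ := landau_three_level (n := k₁ - k₀) (by omega)
  refine ⟨C.toNNReal, fun f hf hfin => ?_⟩
  set a : ℕ → ℝ := fun m => (eContDiffHolderNorm m r f).toReal with ha
  have ha0 : ∀ m, 0 ≤ a m := fun m => ENNReal.toReal_nonneg
  have hS : ∀ (m : ℕ) (η : ℝ), 0 ≤ η → η ≤ 1 → η * a (m + 1) ≤ 3 * a m + η ^ 2 * a (m + 2) :=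
    fun m η hη0 hη1 => toReal_eContDiffHolderNorm_one_step hf hfin m hη0 hη1
  have hM : ∀ m, a m ≤ 3 * a (m + 1) := by
    intro m
    have h := eContDiffHolderNorm_le_three_mul_succ (contDiff_infty.1 hf (m + 1)) hr r
    have h3 : (3 : ℝ≥0∞) * eContDiffHolderNorm (m + 1) r f ≠ ⊤ :=
      ENNReal.mul_ne_top (by norm_num) (hfin (m + 1)).ne
    have h' := ENNReal.toReal_mono h3 h
    rw [ENNReal.toReal_mul] at h'
    have e3 : (3 : ℝ≥0∞).toReal = 3 := by norm_num
    rwa [e3] at h'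
  have key := hC a ha0 hS hM k₀ (k - k₀) (by omega)
  rw [show k₀ + (k - k₀) = k by omega, show k₀ + (k₁ - k₀) = k₁ by omega] at key
  -- exponents
  have hn : ((k₁ - k₀ : ℕ) : ℝ) = (k₁ : ℝ) - k₀ := Nat.cast_sub hlt.le
  have hj : ((k - k₀ : ℕ) : ℝ) = (k : ℝ) - k₀ := Nat.cast_sub h₀
  have hnpos : (0 : ℝ) < (k₁ : ℝ) - k₀ := by
    have : (k₀ : ℝ) < k₁ := by exact_mod_cast hlt
    linarith
  have e1 : 1 - ((k - k₀ : ℕ) : ℝ) / ((k₁ - k₀ : ℕ) : ℝ) = ((k₁ : ℝ) - k) / ((k₁ : ℝ) - k₀) := by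
    rw [hn, hj]
    field_simp
    ring
  have e2 : ((k - k₀ : ℕ) : ℝ) / ((k₁ - k₀ : ℕ) : ℝ) = ((k : ℝ) - k₀) / ((k₁ : ℝ) - k₀) := by
    rw [hn, hj]
  rw [e1, e2] at key
  have hp0 : 0 ≤ ((k₁ : ℝ) - k) / ((k₁ : ℝ) - k₀) :=
    div_nonneg (sub_nonneg.2 (by exact_mod_cast h₁)) hnpos.le
  have hq0 : 0 ≤ ((k : ℝ) - k₀) / ((k₁ : ℝ) - k₀) :=
    div_nonneg (sub_nonneg.2 (by exact_mod_cast h₀)) hnpos.le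
  -- back to `ℝ≥0∞`
  have eN : ∀ m, eContDiffHolderNorm m r f = ENNReal.ofReal (a m) := fun m =>
    (ENNReal.ofReal_toReal (hfin m).ne).symm
  rw [eN k, eN k₀, eN k₁, ENNReal.ofReal_rpow_of_nonneg (ha0 _) hp0,
    ENNReal.ofReal_rpow_of_nonneg (ha0 _) hq0,
    show ((C.toNNReal : ℝ≥0) : ℝ≥0∞) = ENNReal.ofReal C from rfl,
    ← ENNReal.ofReal_mul hC0, ← ENNReal.ofReal_mul (mul_nonneg hC0 (Real.rpow_nonneg (ha0 _) _))]
  exact ENNReal.ofReal_le_ofReal key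

end ThreeLevel

/-! ## The torus version -/

namespace Torus

variable {d : Type} [Fintype d] {Y : Type} [NormedAddCommGroup Y] [NormedSpace ℝ Y]

/-- **Three-level interpolation inequality on the flat torus** (BDSV App. A (A.1)/(A.3); App. D,
proof of Prop. D.1: `‖b‖_{j+1+α} ≲ ‖b‖_{1+α}^{1-j/N}‖b‖_{N+1+α}^{j/N}`,
`‖f‖_{N-j+α} ≲ ‖f‖_{N+α}^{1-j/N}‖f‖_α^{j/N}`): for `r ≤ 1` and integers `k₀ ≤ k ≤ k₁`, `k₀ < k₁`,
there is `C` such that for every smooth `g : T^d → Y`,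
`‖g‖_{k,r} ≤ C ‖g‖_{k₀,r}^{(k₁-k)/(k₁-k₀)} ‖g‖_{k₁,r}^{(k-k₀)/(k₁-k₀)}` in the norms
`Torus.eContDiffHolderNorm`. [cite: BuckmasterEtAl2018, App. A (A.1)–(A.3)] -/
theorem eContDiffHolderNorm_interpolation {r : ℝ≥0} (hr : r ≤ 1) {k₀ k k₁ : ℕ} (h₀ : k₀ ≤ k)
    (h₁ : k ≤ k₁) (hlt : k₀ < k₁) :
    ∃ C : ℝ≥0, ∀ g : UnitAddTorus d → Y, IsSmooth g →
      Torus.eContDiffHolderNorm k r g ≤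
        C * Torus.eContDiffHolderNorm k₀ r g ^ (((k₁ : ℝ) - k) / ((k₁ : ℝ) - k₀)) *
          Torus.eContDiffHolderNorm k₁ r g ^ (((k : ℝ) - k₀) / ((k₁ : ℝ) - k₀)) := by
  obtain ⟨C, hC⟩ := FunctionSpaces.eContDiffHolderNorm_interpolation
    (E' := EuclideanSpace ℝ d) (Y := Y) hr h₀ h₁ hlt
  exact ⟨C, fun g hg => hC (lift g) hg fun m => hg.eContDiffHolderNorm_lt_top m hr⟩

end Torus

end Literature.Analysis.FunctionSpaces
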